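import Literature.NumberTheory.Automorphic.QuaternionSplitMatrixModel
import Literature.NumberTheory.Automorphic.QuaternionCoordOrderAdelicLiftProofs
import Literature.NumberTheory.Automorphic.StrongApproximationGL2
import Literature.NumberTheory.Automorphic.UnramifiedHeckeScalarsProofs
import HarnessLib

/-!
# Strong approximation for the norm-one group of a split `ℍ[K,a,b]`; the split case of
# `coordOrder_heckeDoubleCoset`

Topic `NumberTheory/Automorphic`; fourth companion ("proofs") file of `QuaternionCoordOrder`.
Definitions and theorems only (no named fact).

The accepted reduction `coordOrder_heckeDoubleCoset_of_forall_finiteAdele_dense`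
(`QuaternionCoordOrderAdelicLiftProofs`) derives the named fact
`QuaternionAlgebra.coordOrder_heckeDoubleCoset` from Kneser's strong approximation theorem in its
finite-adelic form `SA_f` (Vignéras, LNM 800, Ch. III §4 Thm. 4.3, `S = ∞`: the norm-one elements
of `ℍ[K,a,b]` are dense in those of `ℍ[𝔸_K^∞,a,b]`). Here we PROVE `SA_f` for the **split**
quaternion algebras `ℍ[K,a,b] ≃ M₂(K)` (`b = s² - a t²` solvable in `K`, Vignéras I §2 Cor. 2.4),
from strong approximation for `SL₂` (`StrongApproximationSL2`, Platonov–Rapinchuk Thm. 7.12 for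
`G = SL₂`, PROVED in the tree), and deduce the conclusion of the named fact for every such
`ℍ[K,a,b]` at every principal place `v ∤ 2ab` (`coordOrder_heckeDoubleCoset_of_split`).

* `slTwoCongruence K 𝔫` : the principal congruence subgroup
  `{u ∈ SL₂(𝔸_K^∞) : u ≡ 1 (mod 𝔫 𝒪̂_K)}` (entries of `u - 1` in `levelIdeal K 𝔫` of
  `StrongApproximationGL2`), open (`isOpen_slTwoCongruence`), and **cofinal among the
  neighbourhoods of `1` in `SL₂(𝔸_K^∞)`** (`exists_slTwoCongruence_subset`, from
  `FiniteAdeleRing.exists_forall_valued_le_idealRadius_imp_mem` of `UnramifiedHeckeScalarsProofs`: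
  ideal boxes are cofinal among the neighbourhoods of `0` in `𝔸_K^∞`).
* `finiteAdele_dense_of_split` : **`SA_f` for split `ℍ[K,a,b]`.** With the explicit
  `𝔸_K^∞`-algebra isomorphism `ψ : ℍ[𝔸_K^∞,a,b] ≃ M₂(𝔸_K^∞)` of `QuaternionSplitMatrixModel`
  (`det ψ = nrd`, so `ψ` carries norm-one elements to `SL₂`; compatible with `ψ_K` on
  `ℍ[K,a,b]`): given `y` of norm `1` and an open `V ∋ 0`, the maps
  `u ↦ coordinates of y ψ⁻¹(u⁻¹) - y` are continuous `SL₂(𝔸_K^∞) → 𝔸_K^∞` vanishing at `1`, so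
  they take values in `V` on some `slTwoCongruence K 𝔫`; writing `ψ(y) = γ u` with `γ ∈ SL₂(K)`,
  `u` in that subgroup (`exists_specialLinearGroup_map_mul_eq`), `x = ψ_K⁻¹(γ)` has norm `1` and
  `ι(x) = y ψ⁻¹(u⁻¹)`, whose coordinates differ from those of `y` by elements of `V`.
* `coordOrder_heckeDoubleCoset_of_split` : hence, for split `ℍ[K,a,b]`, `v = (ϖ) ∤ 2ab`, `g ∈ O`
  with `g ḡ = ϖ`: `Γ g Γ = {x ∈ O : x x̄ ∈ 𝓞_K^× ϖ}` and `[Γ : Γ ∩ g⁻¹ Γ g] = q_v + 1`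
  (`normOne_adicCompletion_dense_of_finiteAdele_dense` and
  `coordOrder_heckeDoubleCoset_of_adicCompletion_dense`).

## References

* M.-F. Vignéras, *Arithmétique des algèbres de quaternions*, LNM 800 (1980): Ch. I §2 Cor. 2.4;
  Ch. III §4 Thm. 4.3 [VignerasLNM800].
* V. Platonov, A. Rapinchuk, *Algebraic groups and number theory* (1994), Thm. 7.12
  [PlatonovRapinchuk1994].
* G. Shimura, *Introduction to the arithmetic theory of automorphic functions* (1971), §3.1,
  Prop. 3.1 [Shimura1971].
-/

noncomputable section

open scoped Quaternion Pointwise MatrixGroups Topology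
open NumberField IsDedekindDomain Matrix

namespace Literature.NumberTheory.Automorphic

/-! ### Principal congruence subgroups of `SL₂(𝔸_K^∞)` -/

section Congruence

variable (K : Type) [Field K] [NumberField K]

/-- `𝔸_K^∞`. -/
local notation "𝔸ᶠ" => FiniteAdeleRing (𝓞 K) K

/-- The **principal congruence subgroup of level `𝔫`** of `SL₂(𝔸_K^∞)`:
`{u : u ≡ 1 (mod 𝔫𝒪̂_K)}`, i.e. all entries of `u - 1` lie in `levelIdeal K 𝔫 = 𝔫𝒪̂_K`
(Bump (1997), §3.3; a subgroup because `𝔫𝒪̂_K ⊆ 𝒪̂_K` is an ideal of `𝒪̂_K` and `u⁻¹ = adj u` on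
`SL₂`). [folklore] -/
def slTwoCongruence (𝔫 : Ideal (𝓞 K)) : Subgroup SL(2, 𝔸ᶠ) where
  carrier := {u | ∀ i j, ((u : Matrix (Fin 2) (Fin 2) 𝔸ᶠ) - 1) i j ∈ levelIdeal K 𝔫}
  one_mem' i j := by
    rw [Matrix.SpecialLinearGroup.coe_one, sub_self, Matrix.zero_apply]
    exact (levelIdeal K 𝔫).zero_mem
  mul_mem' {u v} hu hv i j := by
    have h : ((u * v : SL(2, 𝔸ᶠ)) : Matrix (Fin 2) (Fin 2) 𝔸ᶠ) - 1 =
        ((u : Matrix (Fin 2) (Fin 2) 𝔸ᶠ) - 1) * ((v : Matrix (Fin 2) (Fin 2) 𝔸ᶠ) - 1) +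
          ((u : Matrix (Fin 2) (Fin 2) 𝔸ᶠ) - 1) + ((v : Matrix (Fin 2) (Fin 2) 𝔸ᶠ) - 1) := by
      rw [Matrix.SpecialLinearGroup.coe_mul]
      noncomm_ring
    rw [h, Matrix.add_apply, Matrix.add_apply, Matrix.mul_apply, Fin.sum_univ_two]
    exact add_mem (add_mem (add_mem
      (mul_mem_levelIdeal' (hu i 0) (mem_integralFiniteAdeles_of_mem_levelIdeal (hv 0 j)))
      (mul_mem_levelIdeal' (hu i 1) (mem_integralFiniteAdeles_of_mem_levelIdeal (hv 1 j))))
      (hu i j)) (hv i j)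
  inv_mem' {u} hu i j := by
    rw [Matrix.SpecialLinearGroup.coe_inv, Matrix.adjugate_fin_two]
    have h00 := hu 0 0
    have h01 := hu 0 1
    have h10 := hu 1 0
    have h11 := hu 1 1
    simp only [Matrix.sub_apply, Matrix.one_apply_eq, Matrix.one_apply_ne (show (0 : Fin 2) ≠ 1
      by decide), Matrix.one_apply_ne (show (1 : Fin 2) ≠ 0 by decide), sub_zero] at h00 h01 h10 h11
    fin_cases i <;> fin_cases j <;>
      simp only [Matrix.sub_apply, Matrix.of_apply, Matrix.cons_val', Matrix.cons_val_zero,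
        Matrix.cons_val_one, Matrix.cons_val_fin_one, Fin.zero_eta, Fin.mk_one,
        Matrix.one_apply_eq, Matrix.one_apply_ne (show (0 : Fin 2) ≠ 1 by decide),
        Matrix.one_apply_ne (show (1 : Fin 2) ≠ 0 by decide), sub_zero]
    · exact h11
    · exact neg_mem h01
    · exact neg_mem h10
    · exact h00

variable {K} in
/-- Membership in `slTwoCongruence K 𝔫` (definitional). [folklore] -/
theorem mem_slTwoCongruence_iff {𝔫 : Ideal (𝓞 K)} {u : SL(2, 𝔸ᶠ)} :
    u ∈ slTwoCongruence K 𝔫 ↔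
      ∀ i j, ((u : Matrix (Fin 2) (Fin 2) 𝔸ᶠ) - 1) i j ∈ levelIdeal K 𝔫 :=
  Iff.rfl

/-- `slTwoCongruence K 𝔫` is open in `SL₂(𝔸_K^∞)` (finite intersection of preimages of the open
`𝔫𝒪̂_K` under the continuous entries). [folklore] -/
theorem isOpen_slTwoCongruence (𝔫 : Ideal (𝓞 K)) :
    IsOpen (slTwoCongruence K 𝔫 : Set SL(2, 𝔸ᶠ)) := by
  have h : (slTwoCongruence K 𝔫 : Set SL(2, 𝔸ᶠ)) =
      ⋂ i : Fin 2, ⋂ j : Fin 2, (fun u : SL(2, 𝔸ᶠ) => ((u : Matrix (Fin 2) (Fin 2) 𝔸ᶠ) - 1) i j) ⁻¹'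
        (levelIdeal K 𝔫 : Set 𝔸ᶠ) := by
    ext u
    simp only [SetLike.mem_coe, mem_slTwoCongruence_iff, Set.mem_iInter, Set.mem_preimage]
  rw [h]
  exact isOpen_iInter_of_finite fun i => isOpen_iInter_of_finite fun j =>
    (isOpen_levelIdeal 𝔫).preimage ((continuous_subtype_val.sub continuous_const).matrix_elem i j)

/-- **Principal congruence subgroups are cofinal among the neighbourhoods of `1` in
`SL₂(𝔸_K^∞)`**: every open `W ∋ 1` contains `slTwoCongruence K 𝔫` for some `𝔫 ≠ 0` (the
entries of `u - 1` range over a box of `M₂(𝔸_K^∞) = (𝔸_K^∞)⁴`, and ideal boxes are cofinal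
among the neighbourhoods of `0` in `𝔸_K^∞`, `FiniteAdeleRing.exists_forall_valued_le_idealRadius_imp_mem`;
Cassels–Fröhlich, Ch. II §14). [folklore] -/
theorem exists_slTwoCongruence_subset {W : Set SL(2, 𝔸ᶠ)} (hW : IsOpen W) (h1 : (1 : SL(2, 𝔸ᶠ)) ∈ W) :
    ∃ 𝔫 : Ideal (𝓞 K), 𝔫 ≠ 0 ∧ (slTwoCongruence K 𝔫 : Set SL(2, 𝔸ᶠ)) ⊆ W := by
  classical
  obtain ⟨W', hW', rfl⟩ := isOpen_induced_iff.mp hW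
  have h1' : (1 : Matrix (Fin 2) (Fin 2) 𝔸ᶠ) ∈ W' := by
    rw [Set.mem_preimage, Matrix.SpecialLinearGroup.coe_one] at h1
    exact h1
  -- translate to a neighbourhood of `0` in `M₂(𝔸_K^∞) = Fin 2 → Fin 2 → 𝔸_K^∞`
  have hW'' : (fun d : Matrix (Fin 2) (Fin 2) 𝔸ᶠ => (1 : Matrix (Fin 2) (Fin 2) 𝔸ᶠ) + d) ⁻¹' W' ∈
      𝓝 (0 : Matrix (Fin 2) (Fin 2) 𝔸ᶠ) :=
    (hW'.preimage (continuous_const.add continuous_id)).mem_nhds (by simpa using h1')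
  -- the same neighbourhood, seen in the product type `Fin 2 → Fin 2 → 𝔸_K^∞`
  have hW''' : (fun d : Fin 2 → Fin 2 → 𝔸ᶠ =>
      (1 : Matrix (Fin 2) (Fin 2) 𝔸ᶠ) + Matrix.of d) ⁻¹' W' ∈ 𝓝 (0 : Fin 2 → Fin 2 → 𝔸ᶠ) := hW''
  rw [nhds_pi, Filter.mem_pi] at hW'''
  obtain ⟨I, -, t₁, ht₁, hsub₁⟩ := hW'''
  have h2 : ∀ i : Fin 2, ∃ t₂ : Fin 2 → Set 𝔸ᶠ, (∀ j, t₂ j ∈ 𝓝 (0 : 𝔸ᶠ)) ∧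
      ∀ f : Fin 2 → 𝔸ᶠ, (∀ j, f j ∈ t₂ j) → f ∈ t₁ i := fun i => by
    have h := ht₁ i
    rw [Pi.zero_apply, nhds_pi, Filter.mem_pi] at h
    obtain ⟨I₂, -, t₂, ht₂, hsub₂⟩ := h
    exact ⟨t₂, ht₂, fun f hf => hsub₂ fun j _ => hf j⟩
  choose t₂ ht₂ hsub₂ using h2
  have h3 : ∀ i j : Fin 2, ∃ 𝔫 : Ideal (𝓞 K), 𝔫 ≠ 0 ∧
      ∀ x : 𝔸ᶠ, (∀ v, Valued.v (x v) ≤ idealRadius K v 𝔫) → x ∈ t₂ i j := fun i j =>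
    FiniteAdeleRing.exists_forall_valued_le_idealRadius_imp_mem K (ht₂ i j)
  choose 𝔫 h𝔫0 h𝔫 using h3
  have hprod : (∏ i : Fin 2, ∏ j : Fin 2, 𝔫 i j) ≠ 0 := by
    rw [Finset.prod_ne_zero_iff]
    intro i _
    rw [Finset.prod_ne_zero_iff]
    intro j _
    exact h𝔫0 i j
  refine ⟨∏ i : Fin 2, ∏ j : Fin 2, 𝔫 i j, hprod, fun u hu => ?_⟩
  rw [Set.mem_preimage]
  have hu1 : (u : Matrix (Fin 2) (Fin 2) 𝔸ᶠ) =
      (1 : Matrix (Fin 2) (Fin 2) 𝔸ᶠ) + ((u : Matrix (Fin 2) (Fin 2) 𝔸ᶠ) - 1) := by abel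
  rw [hu1]
  refine hsub₁ fun i _ => hsub₂ i _ fun j => h𝔫 i j _ fun v => (hu i j v).trans ?_
  refine idealRadius_le_of_dvd K v hprod ((Finset.dvd_prod_of_mem (fun j => 𝔫 i j)
    (Finset.mem_univ j)).trans (Finset.dvd_prod_of_mem (fun i => ∏ j : Fin 2, 𝔫 i j)
    (Finset.mem_univ i)))

end Congruence

namespace QuaternionAlgebra

/-- `ℍ⟮K; R; a, b⟯ := ℍ[K, algebraMap R K a, algebraMap R K b]` (file-local notation, as in
`QuaternionCoordOrder`). -/
local notation "ℍ⟮" K "; " R "; " a ", " b "⟯" =>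
  QuaternionAlgebra K (algebraMap R K a) (0 : K) (algebraMap R K b)

/-! ### Strong approximation for the norm-one group of a split `ℍ[K,a,b]` -/

section Split

variable {K : Type} [Field K] [NumberField K] (a b : 𝓞 K)

/-- `𝔸_K^∞`. -/
local notation "𝔸ᶠ" => FiniteAdeleRing (𝓞 K) K

/-- The structure constants of `ℍ[𝔸_K^∞,a,b]` are the diagonal images of those of `ℍ[K,a,b]`.
[folklore] -/
theorem algebraMap_finiteAdele_integers (r : 𝓞 K) :
    algebraMap K 𝔸ᶠ (algebraMap (𝓞 K) K r) = algebraMap (𝓞 K) 𝔸ᶠ r :=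
  (IsScalarTower.algebraMap_apply (𝓞 K) K 𝔸ᶠ r).symm

/-- `s² - a t² = b` in `K` gives the same relation in `𝔸_K^∞`. [folklore] -/
theorem sq_sub_mul_sq_finiteAdele {s₀ t₀ : K}
    (hst : s₀ ^ 2 - algebraMap (𝓞 K) K a * t₀ ^ 2 = algebraMap (𝓞 K) K b) :
    algebraMap K 𝔸ᶠ s₀ ^ 2 - algebraMap (𝓞 K) 𝔸ᶠ a * algebraMap K 𝔸ᶠ t₀ ^ 2 =
      algebraMap (𝓞 K) 𝔸ᶠ b := by
  have h := congrArg (algebraMap K 𝔸ᶠ) hst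
  rw [map_sub, map_pow, map_mul, map_pow, algebraMap_finiteAdele_integers,
    algebraMap_finiteAdele_integers] at h
  exact h

/-- `2ab ∈ K^×` for `a, b ≠ 0`. [folklore] -/
theorem isUnit_two_mul (ha : a ≠ 0) (hb : b ≠ 0) :
    IsUnit (2 * algebraMap (𝓞 K) K a * algebraMap (𝓞 K) K b) := by
  have hinj := FaithfulSMul.algebraMap_injective (𝓞 K) K
  refine isUnit_iff_ne_zero.mpr (mul_ne_zero (mul_ne_zero two_ne_zero ?_) ?_)
  · exact (map_ne_zero_iff _ hinj).mpr ha
  · exact (map_ne_zero_iff _ hinj).mpr hb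

/-- `2ab` is a unit of `𝔸_K^∞` (the diagonal image of a unit of `K`). [folklore] -/
theorem isUnit_two_mul_finiteAdele (ha : a ≠ 0) (hb : b ≠ 0) :
    IsUnit (2 * algebraMap (𝓞 K) 𝔸ᶠ a * algebraMap (𝓞 K) 𝔸ᶠ b) := by
  have h := (isUnit_two_mul a b ha hb).map (algebraMap K 𝔸ᶠ)
  rwa [map_mul, map_mul, map_ofNat, algebraMap_finiteAdele_integers,
    algebraMap_finiteAdele_integers] at h

/-- The splittings over `K` and over `𝔸_K^∞` are compatible with the diagonal map `ι`:
`ψ_𝔸(ι x) = ψ_K(x)` entrywise. [folklore] -/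
theorem splitHom_toFiniteAdele {s₀ t₀ : K}
    (hst : s₀ ^ 2 - algebraMap (𝓞 K) K a * t₀ ^ 2 = algebraMap (𝓞 K) K b)
    (hst' : algebraMap K 𝔸ᶠ s₀ ^ 2 - algebraMap (𝓞 K) 𝔸ᶠ a * algebraMap K 𝔸ᶠ t₀ ^ 2 =
      algebraMap (𝓞 K) 𝔸ᶠ b) (x : ℍ⟮K; 𝓞 K; a, b⟯) :
    splitHom (algebraMap (𝓞 K) 𝔸ᶠ a) (algebraMap (𝓞 K) 𝔸ᶠ b) (algebraMap K 𝔸ᶠ s₀)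
        (algebraMap K 𝔸ᶠ t₀) hst' (toFiniteAdele a b x) =
      (splitHom (algebraMap (𝓞 K) K a) (algebraMap (𝓞 K) K b) s₀ t₀ hst x).map
        (algebraMap K 𝔸ᶠ) := by
  rw [splitHom_apply, splitHom_apply, toFiniteAdele_apply, splitLin_apply, splitLin_apply]
  ext i j
  fin_cases i <;> fin_cases j <;>
    simp [map_add, map_sub, map_mul, algebraMap_finiteAdele_integers]

/-- For fixed `y ∈ ℍ[𝔸_K^∞,a,b]`, the coordinates of `y ψ⁻¹(m) - y` are continuous functions of the
matrix `m ∈ M₂(𝔸_K^∞)` (polynomials in the entries). [folklore] -/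
theorem continuous_coords_mul_splitSection {s t : 𝔸ᶠ}
    (hδ : IsUnit (2 * algebraMap (𝓞 K) 𝔸ᶠ a * algebraMap (𝓞 K) 𝔸ᶠ b)) (y : ℍ⟮𝔸ᶠ; 𝓞 K; a, b⟯) :
    (Continuous fun m : Matrix (Fin 2) (Fin 2) 𝔸ᶠ => (y * splitSection s t hδ m - y).re) ∧
    (Continuous fun m : Matrix (Fin 2) (Fin 2) 𝔸ᶠ => (y * splitSection s t hδ m - y).imI) ∧
    (Continuous fun m : Matrix (Fin 2) (Fin 2) 𝔸ᶠ => (y * splitSection s t hδ m - y).imJ) ∧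
    (Continuous fun m : Matrix (Fin 2) (Fin 2) 𝔸ᶠ => (y * splitSection s t hδ m - y).imK) := by
  have h00 : Continuous fun m : Matrix (Fin 2) (Fin 2) 𝔸ᶠ => m 0 0 := continuous_id.matrix_elem 0 0
  have h01 : Continuous fun m : Matrix (Fin 2) (Fin 2) 𝔸ᶠ => m 0 1 := continuous_id.matrix_elem 0 1
  have h10 : Continuous fun m : Matrix (Fin 2) (Fin 2) 𝔸ᶠ => m 1 0 := continuous_id.matrix_elem 1 0
  have h11 : Continuous fun m : Matrix (Fin 2) (Fin 2) 𝔸ᶠ => m 1 1 := continuous_id.matrix_elem 1 1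
  simp only [_root_.QuaternionAlgebra.re_sub, _root_.QuaternionAlgebra.imI_sub,
    _root_.QuaternionAlgebra.imJ_sub, _root_.QuaternionAlgebra.imK_sub,
    _root_.QuaternionAlgebra.re_mul, _root_.QuaternionAlgebra.imI_mul,
    _root_.QuaternionAlgebra.imJ_mul, _root_.QuaternionAlgebra.imK_mul,
    splitSection_re, splitSection_imI, splitSection_imJ, splitSection_imK]
  refine ⟨?_, ?_, ?_, ?_⟩ <;> fun_prop

/-- **Strong approximation `SA_f` for the norm-one group of a split quaternion algebra.** Let
`a, b ∈ 𝓞 K ∖ 0` with `b = s₀² - a t₀²` solvable in `K` (so `ℍ[K,a,b] ≃ M₂(K)`, Vignéras I §2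
Cor. 2.4). Then the norm-one elements of `ℍ[K,a,b]` are dense in those of `ℍ[𝔸_K^∞,a,b]` for the
coordinate topology — Vignéras III §4 Thm. 4.3 in the split case, where it is strong approximation
for `SL₂` (Platonov–Rapinchuk Thm. 7.12; `exists_specialLinearGroup_map_mul_eq` of
`StrongApproximationSL2`) transported through `ψ : ℍ[𝔸_K^∞,a,b] ≃ M₂(𝔸_K^∞)`.
[cite: VignerasLNM800, Ch. III §4 Thm. 4.3] [cite: PlatonovRapinchuk1994, Thm. 7.12] -/
theorem finiteAdele_dense_of_split (ha : a ≠ 0) (hb : b ≠ 0) {s₀ t₀ : K}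
    (hst : s₀ ^ 2 - algebraMap (𝓞 K) K a * t₀ ^ 2 = algebraMap (𝓞 K) K b) :
    ∀ y : ℍ⟮𝔸ᶠ; 𝓞 K; a, b⟯, y * star y = 1 →
      ∀ V : Set 𝔸ᶠ, IsOpen V → (0 : 𝔸ᶠ) ∈ V →
        ∃ x : ℍ⟮K; 𝓞 K; a, b⟯, x * star x = 1 ∧ algebraMap K 𝔸ᶠ x.re - y.re ∈ V ∧
          algebraMap K 𝔸ᶠ x.imI - y.imI ∈ V ∧ algebraMap K 𝔸ᶠ x.imJ - y.imJ ∈ V ∧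
          algebraMap K 𝔸ᶠ x.imK - y.imK ∈ V := by
  intro y hy V hV hV0
  have hst' := sq_sub_mul_sq_finiteAdele a b hst
  have hδK := isUnit_two_mul a b ha hb
  have hδA := isUnit_two_mul_finiteAdele a b ha hb
  -- notation-free abbreviations for the two splittings
  set ψA := splitHom (algebraMap (𝓞 K) 𝔸ᶠ a) (algebraMap (𝓞 K) 𝔸ᶠ b) (algebraMap K 𝔸ᶠ s₀)
    (algebraMap K 𝔸ᶠ t₀) hst' with hψA
  -- `g = ψ(y) ∈ SL₂(𝔸)`
  have hdet : (ψA y).det = 1 := by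
    rw [hψA, det_splitHom, ← mul_star_eq_one_iff_coords]
    exact hy
  set g : SL(2, 𝔸ᶠ) := ⟨ψA y, hdet⟩ with hg
  -- the coordinates of `y ψ⁻¹(u⁻¹) - y` are continuous in `u ∈ SL₂(𝔸)` and vanish at `1`
  set Z : Matrix (Fin 2) (Fin 2) 𝔸ᶠ → ℍ⟮𝔸ᶠ; 𝓞 K; a, b⟯ :=
    splitSection (algebraMap K 𝔸ᶠ s₀) (algebraMap K 𝔸ᶠ t₀) hδA with hZ
  have hinv : Continuous fun u : SL(2, 𝔸ᶠ) => ((u⁻¹ : SL(2, 𝔸ᶠ)) : Matrix (Fin 2) (Fin 2) 𝔸ᶠ) :=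
    continuous_subtype_val.comp continuous_inv
  obtain ⟨cre, cimI, cimJ, cimK⟩ :=
    continuous_coords_mul_splitSection a b (s := algebraMap K 𝔸ᶠ s₀) (t := algebraMap K 𝔸ᶠ t₀) hδA y
  set W : Set SL(2, 𝔸ᶠ) := {u | (y * Z ((u⁻¹ : SL(2, 𝔸ᶠ)) : Matrix (Fin 2) (Fin 2) 𝔸ᶠ) - y).re ∈ V ∧
    (y * Z ((u⁻¹ : SL(2, 𝔸ᶠ)) : Matrix (Fin 2) (Fin 2) 𝔸ᶠ) - y).imI ∈ V ∧
    (y * Z ((u⁻¹ : SL(2, 𝔸ᶠ)) : Matrix (Fin 2) (Fin 2) 𝔸ᶠ) - y).imJ ∈ V ∧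
    (y * Z ((u⁻¹ : SL(2, 𝔸ᶠ)) : Matrix (Fin 2) (Fin 2) 𝔸ᶠ) - y).imK ∈ V} with hW
  have hWopen : IsOpen W :=
    (hV.preimage (cre.comp hinv)).and ((hV.preimage (cimI.comp hinv)).and
      ((hV.preimage (cimJ.comp hinv)).and (hV.preimage (cimK.comp hinv))))
  have hZ1 : Z 1 = 1 := splitSection_one hδA
  have h1W : (1 : SL(2, 𝔸ᶠ)) ∈ W := by
    simp only [hW, Set.mem_setOf_eq, inv_one, Matrix.SpecialLinearGroup.coe_one, hZ1, mul_one,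
      sub_self]
    exact ⟨by simpa using hV0, by simpa using hV0, by simpa using hV0, by simpa using hV0⟩
  -- a principal congruence subgroup inside `W`, and strong approximation for `SL₂`
  obtain ⟨𝔫, -, h𝔫W⟩ := exists_slTwoCongruence_subset K hWopen h1W
  obtain ⟨γ, u, hu, hγu⟩ := exists_specialLinearGroup_map_mul_eq (𝓞 K) K
    (slTwoCongruence K 𝔫) (isOpen_slTwoCongruence K 𝔫) g
  -- the global element `x = ψ_K⁻¹(γ)`
  set x : ℍ⟮K; 𝓞 K; a, b⟯ := (splitEquiv hst hδK).symm (γ : Matrix (Fin 2) (Fin 2) K) with hx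
  have hψx : splitHom (algebraMap (𝓞 K) K a) (algebraMap (𝓞 K) K b) s₀ t₀ hst x = γ := by
    rw [hx, ← splitEquiv_apply hst hδK, AlgEquiv.apply_symm_apply]
  have hx1 : x * star x = 1 := by
    rw [mul_star_eq_one_iff_coords, ← det_splitHom hst, hψx]
    exact γ.prop
  -- `ι(x) = y ψ⁻¹(u⁻¹)`
  have hψZ : ∀ m, ψA (Z m) = m := fun m => by
    rw [hψA, hZ]
    exact splitHom_splitSection hst' hδA m
  have hψι : ψA (toFiniteAdele a b x) = (γ : Matrix (Fin 2) (Fin 2) K).map (algebraMap K 𝔸ᶠ) := by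
    rw [hψA, splitHom_toFiniteAdele a b hst hst', hψx]
  have hγ' : (γ : Matrix (Fin 2) (Fin 2) K).map (algebraMap K 𝔸ᶠ) =
      ψA y * ((u⁻¹ : SL(2, 𝔸ᶠ)) : Matrix (Fin 2) (Fin 2) 𝔸ᶠ) := by
    have h := congrArg (fun w : SL(2, 𝔸ᶠ) => (w : Matrix (Fin 2) (Fin 2) 𝔸ᶠ)) hγu
    simp only [Matrix.SpecialLinearGroup.coe_mul, Matrix.SpecialLinearGroup.map_apply_coe,
      RingHom.mapMatrix_apply] at h
    -- `h : (γ.map f) * ↑u = ↑g = ψA y`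
    calc (γ : Matrix (Fin 2) (Fin 2) K).map (algebraMap K 𝔸ᶠ)
        = (γ : Matrix (Fin 2) (Fin 2) K).map (algebraMap K 𝔸ᶠ) * (u : Matrix (Fin 2) (Fin 2) 𝔸ᶠ) *
            ((u⁻¹ : SL(2, 𝔸ᶠ)) : Matrix (Fin 2) (Fin 2) 𝔸ᶠ) := by
          rw [mul_assoc, ← Matrix.SpecialLinearGroup.coe_mul, mul_inv_cancel,
            Matrix.SpecialLinearGroup.coe_one, mul_one]
      _ = ψA y * ((u⁻¹ : SL(2, 𝔸ᶠ)) : Matrix (Fin 2) (Fin 2) 𝔸ᶠ) := by rw [h]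
  have hkey : toFiniteAdele a b x = y * Z ((u⁻¹ : SL(2, 𝔸ᶠ)) : Matrix (Fin 2) (Fin 2) 𝔸ᶠ) := by
    refine splitHom_injective hst' hδA ?_
    rw [← hψA, hψι, map_mul, hψZ, hγ']
  -- conclusion: the coordinates of `ι(x) - y` are those of `y ψ⁻¹(u⁻¹) - y`, in `V` as `u ∈ W`
  have huW := h𝔫W hu
  simp only [hW, Set.mem_setOf_eq, ← hkey, _root_.QuaternionAlgebra.re_sub,
    _root_.QuaternionAlgebra.imI_sub, _root_.QuaternionAlgebra.imJ_sub,
    _root_.QuaternionAlgebra.imK_sub, toFiniteAdele_apply] at huW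
  exact ⟨x, hx1, huW⟩

/-- **The conclusion of `coordOrder_heckeDoubleCoset` for split `ℍ[K,a,b]`** (unconditional):
`a, b ∈ 𝓞 K ∖ 0` with `b = s₀² - a t₀²` solvable in `K`, `v = (ϖ) ∤ 2ab`, `g ∈ O` with `g ḡ = ϖ`;
then `Γ g Γ = {x ∈ O : x x̄ ∈ 𝓞_K^× ϖ}` and `[Γ : Γ ∩ g⁻¹ Γ g] = q_v + 1` for `Γ = O^×`
(`finiteAdele_dense_of_split`, `normOne_adicCompletion_dense_of_finiteAdele_dense`,
`coordOrder_heckeDoubleCoset_of_adicCompletion_dense`; Vignéras II §2 Thm. 2.3 globalised by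
strong approximation for `SL₂`; Shimura 1971 Prop. 3.1).
[cite: VignerasLNM800, Ch. II §2 Thm. 2.3 and Ch. III §4 Thm. 4.3] [cite: Shimura1971, Prop. 3.1] -/
theorem coordOrder_heckeDoubleCoset_of_split (ha : a ≠ 0) (hb : b ≠ 0) {s₀ t₀ : K}
    (hst : s₀ ^ 2 - algebraMap (𝓞 K) K a * t₀ ^ 2 = algebraMap (𝓞 K) K b)
    (v : HeightOneSpectrum (𝓞 K)) (ϖ : 𝓞 K) (g : (ℍ⟮K; 𝓞 K; a, b⟯)ˣ)
    (hv : v.asIdeal = Ideal.span {ϖ}) (h2ab : (2 * a * b : 𝓞 K) ∉ v.asIdeal)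
    (hg : (g : ℍ⟮K; 𝓞 K; a, b⟯) ∈ coordOrder K a b)
    (hgg : (g : ℍ⟮K; 𝓞 K; a, b⟯) * star (g : ℍ⟮K; 𝓞 K; a, b⟯) =
      algebraMap K ℍ⟮K; 𝓞 K; a, b⟯ (ϖ : K)) :
    DoubleCoset.doubleCoset g
        (unitGroup K a b : Set (ℍ⟮K; 𝓞 K; a, b⟯)ˣ)
        (unitGroup K a b : Set (ℍ⟮K; 𝓞 K; a, b⟯)ˣ) =
        {x : (ℍ⟮K; 𝓞 K; a, b⟯)ˣ |
          (x : ℍ⟮K; 𝓞 K; a, b⟯) ∈ coordOrder K a b ∧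
          ∃ ε : (𝓞 K)ˣ, (x : ℍ⟮K; 𝓞 K; a, b⟯) *
            star (x : ℍ⟮K; 𝓞 K; a, b⟯) =
            algebraMap K ℍ⟮K; 𝓞 K; a, b⟯ (((ε : 𝓞 K) * ϖ : 𝓞 K) : K)} ∧
      (MulAut.conj g⁻¹ • unitGroup K a b).relIndex (unitGroup K a b) = v.residueCard + 1 :=
  coordOrder_heckeDoubleCoset_of_adicCompletion_dense a b v ϖ g hv h2ab hg hgg
    (normOne_adicCompletion_dense_of_finiteAdele_dense a b v
      (finiteAdele_dense_of_split a b ha hb hst))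

end Split

end QuaternionAlgebra

end Literature.NumberTheory.Automorphic
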